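import Summits.BirchSwinnertonDyer.BirchSwinnertonDyer.Theses.SignedBaseChange
import Literature.NumberTheory.EllipticCurves.CastellaHsuKunduLeeLiu2025.HeegnerPointMainConjectureSupersingularBDP
import Mathlib.RepresentationTheory.Basic

set_option linter.dupNamespace false -- v5 (critic V#27e π3): the `Cruxes.…` namespace repeats a path segment by design

/-!
# Crux idea `admdef` — first-lemma sketch v6 (ideator bsd-idea-5 g17/g18/g19, lens «transfer»; crux
stmt-BirchSwinnertonDyer-20727 `SignedBaseChange.AnticyclotomicEisensteinDivisibility`; W-79: nothing
registered, no skeleton, no `sorry`; BSD is not proved by any of this).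

The idea runs the Burungale–Skinner–Tian–Wan «(def)» mechanism (arXiv:2409.01350 Thm. 2.5 and its proof,
held text p. 75 L95 – p. 76 L14) at the LEVEL-RAISED DEFINITE vertices `(ξ, K)` of the
Bertolini–Longo–Venerucci induction (arXiv:2306.17784 §7.2.4 «Step 4», held text p. 31 L74–103), where the
admissible prime supplies CLW22's hypothesis (spl)/(iii) and where the hypothesis (ram), false at admissible
primes, is NOT needed: in the (def) proof it only serves to make the constant `λ = ∏_{q ∣ N⁻} c_q(ξ)` of the
interpolation identity `(𝓛_p^{∘,ac}(ξ/K)) = (λ · 𝓛^∘_W(ξ/K))` a `p`-unit, and BLV's Step 4 is consumed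
together with Gross's formula, which carries the same `∏ c_q` — so the Tamagawa power cancels and never has
to be a unit.  The commutative-algebra hinge that makes this precise is PROVED below
(`definiteVertexCancellation`): a two-variable divisibility with arbitrary nonzero CYCLOTOMIC slack
`h ∈ R⟦T₁⟧` (CLW22 Thm. 8.2.1 / BSTW Prop. (Eq) hold only in `Λ_K ⊗_{Λ^cyc} Frac Λ^cyc`) whose divisor
restricts on the anticyclotomic line to `(constant) · θ` with `μ(θ) = 0` (here `θ = 𝓛^∘_W`, `μ = 0` by
Vatsal / Pollack–Weston under (CR), which admissible primes satisfy) yields the slack-free, `μ`-free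
anticyclotomic divisibility `θ ∣ x⁻`; evaluated at the trivial character it is BLV's use of Step 4
(`Sel = 0 ⇒ 𝓛_W(𝟙)` a unit).  It generalises the tree's `μ(G⁻) = 0` cancellation
`Literature.NumberTheory.EllipticCurves.dvd_of_dvd_map_C_mul_of_hasUnitContent_minus`
(YanZhu2026/GreenbergDivisibilityProofs.lean) to divisors of positive `μ` on the anticyclotomic line.

Conventions as in the tree: `PowerSeries (PowerSeries R)` with OUTER variable the cyclotomic `T₁` and inner
variable the anticyclotomic `T₂`; `PowerSeries.constantCoeff` (outer) = restriction to the anticyclotomic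
line (`UnrSeries₂.minus`); `PowerSeries.map PowerSeries.C` embeds the cyclotomic algebra `R⟦T₁⟧`.
`R` is any domain in which every nonzero element is `ϖ^v · unit` (a DVR with uniformiser `ϖ`, e.g.
`𝒪̂^ur_λ`) and `ϖ` stays prime in `R⟦T₂⟧`; NOT claimed over `𝒪_{ℂ_p}`.
-/

namespace Summit.BirchSwinnertonDyer.BirchSwinnertonDyer.Cruxes.AnticyclotomicEisensteinDivisibility.Admdef

/-- `L ∣ π * m`, `π` prime, `π ∤ L` ⇒ `L ∣ m`. -/
theorem dvd_of_dvd_prime_mul {M : Type*} [CommRing M] [IsDomain M] {π L m : M}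
    (hπ : Prime π) (h : L ∣ π * m) (hL : ¬ π ∣ L) : L ∣ m := by
  obtain ⟨r, hr⟩ := h
  have hdvd : π ∣ L * r := ⟨m, by rw [← hr, mul_comm]⟩
  rcases hπ.dvd_or_dvd hdvd with h1 | h1
  · exact absurd h1 hL
  · obtain ⟨r', rfl⟩ := h1
    refine ⟨r', mul_left_cancel₀ hπ.ne_zero ?_⟩
    rw [hr, mul_left_comm]

/-- `θ ∣ π ^ v * b`, `π` prime, `π ∤ θ` ⇒ `θ ∣ b` (the `μ`-cancellation). -/
theorem dvd_of_dvd_prime_pow_mul {M : Type*} [CommRing M] [IsDomain M] {π θ b : M}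
    (hπ : Prime π) (hθ : ¬ π ∣ θ) : ∀ v : ℕ, θ ∣ π ^ v * b → θ ∣ b
  | 0, h => by simpa using h
  | v + 1, h => by
    refine dvd_of_dvd_prime_pow_mul hπ hθ v (dvd_of_dvd_prime_mul hπ ?_ hθ)
    have e : π ^ (v + 1) * b = π * (π ^ v * b) := by rw [pow_succ', mul_assoc]
    rw [e] at h
    exact h

variable {R : Type*} [CommRing R] [IsDomain R]

omit [IsDomain R] in
/-- Restricting an embedded cyclotomic series to the anticyclotomic line gives its constant term. -/
theorem constantCoeff_map_C (h : PowerSeries R) :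
    PowerSeries.constantCoeff (R := PowerSeries R) (PowerSeries.map (PowerSeries.C (R := R)) h)
      = PowerSeries.C (R := R) (PowerSeries.constantCoeff (R := R) h) := by
  rw [← PowerSeries.coeff_zero_eq_constantCoeff_apply, PowerSeries.coeff_map,
    PowerSeries.coeff_zero_eq_constantCoeff_apply]

/-- Peeling the `T₁`-power of the cyclotomic slack (`T₁` is prime in `R⟦T₂⟧⟦T₁⟧` and does not divide a
series with nonzero anticyclotomic restriction): from `L ∣ h · c` with `coeff m h ≠ 0` one gets
`L⁻ ∣ e · c⁻` for a NONZERO constant `e ∈ R`. -/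
theorem minus_dvd_of_dvd_map_C_mul (m : ℕ) :
    ∀ (h : PowerSeries R) (L c : PowerSeries (PowerSeries R)),
      PowerSeries.coeff (R := R) m h ≠ 0 →
      PowerSeries.constantCoeff (R := PowerSeries R) L ≠ 0 →
      L ∣ PowerSeries.map (PowerSeries.C (R := R)) h * c →
      ∃ e : R, e ≠ 0 ∧ PowerSeries.constantCoeff (R := PowerSeries R) L ∣
        PowerSeries.C (R := R) e * PowerSeries.constantCoeff (R := PowerSeries R) c := by
  induction m with
  | zero =>
    intro h L c hm _ hdiv
    refine ⟨PowerSeries.constantCoeff (R := R) h, by simpa using hm, ?_⟩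
    have key := map_dvd (PowerSeries.constantCoeff (R := PowerSeries R)) hdiv
    rwa [map_mul, constantCoeff_map_C] at key
  | succ m' ih =>
    intro h L c hm hL hdiv
    by_cases h0 : PowerSeries.constantCoeff (R := R) h = 0
    · obtain ⟨h', rfl⟩ := PowerSeries.X_dvd_iff.mpr h0
      have hm' : PowerSeries.coeff (R := R) m' h' ≠ 0 := by
        simpa [PowerSeries.coeff_succ_X_mul] using hm
      have hXL : ¬ (PowerSeries.X : PowerSeries (PowerSeries R)) ∣ L := by
        rw [PowerSeries.X_dvd_iff]; exact hL
      have e : PowerSeries.map (PowerSeries.C (R := R)) (PowerSeries.X * h') * c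
          = PowerSeries.X * (PowerSeries.map (PowerSeries.C (R := R)) h' * c) := by
        rw [map_mul, PowerSeries.map_X, mul_assoc]
      rw [e] at hdiv
      exact ih h' L c hm' hL (dvd_of_dvd_prime_mul PowerSeries.X_prime hdiv hXL)
    · refine ⟨PowerSeries.constantCoeff (R := R) h, h0, ?_⟩
      have key := map_dvd (PowerSeries.constantCoeff (R := PowerSeries R)) hdiv
      rwa [map_mul, constantCoeff_map_C] at key

/-- **FIRST LEMMA `L0` — definite-vertex cancellation (PROVED).**  `R` a domain with `ϖ`-normal form
(`e = ϖ^v·u` for every `e ≠ 0`) and `ϖ` prime in `R⟦T₂⟧`; `L, c ∈ R⟦T₂⟧⟦T₁⟧` (analytic / algebraic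
two-variable objects), `h ∈ R⟦T₁⟧ ∖ 0` the cyclotomic slack of a RATIONAL inclusion `L ∣ h·c`;
`L⁻ = λ·θ` on the anticyclotomic line with `λ ∈ R ∖ 0` a CONSTANT (the Tamagawa product `∏_{q∣N⁻} c_q(ξ)`,
BSTW p. 76 L1) and `μ(θ) = 0` (`ϖ ∤ θ`: Vatsal / Pollack–Weston for `θ = 𝓛^∘_W(ξ/K)`).  THEN `θ ∣ c⁻`:
the slack and the Tamagawa power are both gone, with no hypothesis (ram) and no square-freeness. -/
theorem definiteVertexCancellation (ϖ : R)
    (hR : ∀ e : R, e ≠ 0 → ∃ (v : ℕ) (u : Rˣ), e = ϖ ^ v * ↑u)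
    (hϖ : Prime (PowerSeries.C (R := R) ϖ))
    {L c : PowerSeries (PowerSeries R)} {h : PowerSeries R} {lam : R} {θ : PowerSeries R}
    (hh : h ≠ 0) (hdiv : L ∣ PowerSeries.map (PowerSeries.C (R := R)) h * c)
    (hL : PowerSeries.constantCoeff (R := PowerSeries R) L = PowerSeries.C (R := R) lam * θ)
    (hlam : lam ≠ 0) (hμ : ¬ PowerSeries.C (R := R) ϖ ∣ θ) :
    θ ∣ PowerSeries.constantCoeff (R := PowerSeries R) c := by
  obtain ⟨m, hm⟩ : ∃ m, PowerSeries.coeff (R := R) m h ≠ 0 := by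
    by_contra hcon
    push Not at hcon
    exact hh (PowerSeries.ext fun n => by simpa using hcon n)
  have hθ0 : θ ≠ 0 := by
    rintro rfl
    exact hμ (dvd_zero _)
  have hClam : PowerSeries.C (R := R) lam ≠ 0 := fun h0 =>
    hlam (by simpa using congrArg (PowerSeries.constantCoeff (R := R)) h0)
  have hLm : PowerSeries.constantCoeff (R := PowerSeries R) L ≠ 0 := by
    rw [hL]; exact mul_ne_zero hClam hθ0
  obtain ⟨e, he, hdvd⟩ := minus_dvd_of_dvd_map_C_mul m h L c hm hLm hdiv
  rw [hL] at hdvd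
  have hθ : θ ∣ PowerSeries.C (R := R) e * PowerSeries.constantCoeff (R := PowerSeries R) c :=
    dvd_trans (dvd_mul_left θ _) hdvd
  obtain ⟨v, u, rfl⟩ := hR e he
  rw [map_mul, map_pow, mul_assoc] at hθ
  have hθ' := dvd_of_dvd_prime_pow_mul hϖ hμ v hθ
  exact ((u.isUnit.map (PowerSeries.C (R := R))).dvd_mul_left).mp hθ'

/-- **Corollary at the trivial character** (the shape BLV consume in §7.2.4 together with Gross's formula:
`θ(𝟙) ∣ c⁻(𝟙)`, so `Sel_{𝔓^∞}(J_ξ/K) = 0` — which by anticyclotomic control makes `c⁻(𝟙)` a unit —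
forces `𝓛_W(ξ/K)(𝟙) = ψ_ξ(P_K(L))²·unit ∈ 𝒪^×`). -/
theorem definiteVertexCancellation_value (ϖ : R)
    (hR : ∀ e : R, e ≠ 0 → ∃ (v : ℕ) (u : Rˣ), e = ϖ ^ v * ↑u)
    (hϖ : Prime (PowerSeries.C (R := R) ϖ))
    {L c : PowerSeries (PowerSeries R)} {h : PowerSeries R} {lam : R} {θ : PowerSeries R}
    (hh : h ≠ 0) (hdiv : L ∣ PowerSeries.map (PowerSeries.C (R := R)) h * c)
    (hL : PowerSeries.constantCoeff (R := PowerSeries R) L = PowerSeries.C (R := R) lam * θ)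
    (hlam : lam ≠ 0) (hμ : ¬ PowerSeries.C (R := R) ϖ ∣ θ) :
    PowerSeries.constantCoeff (R := R) θ ∣
      PowerSeries.constantCoeff (R := R) (PowerSeries.constantCoeff (R := PowerSeries R) c) :=
  map_dvd (PowerSeries.constantCoeff (R := R)) (definiteVertexCancellation ϖ hR hϖ hh hdiv hL hlam hμ)

/-- The crux served (by name; untouched): the idea supplies BLV's Step-4 input on the all-additive cell,
through which the LEAD's line `bdpline` (`bdpLowerHalfRatSS_allAdditive_of_BLV`) reaches this anchor
child.  Recorded only so that the sketch names its target. -/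
abbrev Target : Prop :=
  Summit.BirchSwinnertonDyer.BirchSwinnertonDyer.Theses.SignedBaseChange.AnticyclotomicEisensteinDivisibility


/-- **Unit-insensitive form (critic V#27a price P5).**  BSTW state `(𝓛^{∘,ac}_p(ξ/K)) = (∏ c_q · 𝓛^∘_W(ξ/K))`
as an equality of IDEALS, i.e. `L⁻` and `λ·θ` are only associated; the cancellation is unchanged. -/
theorem definiteVertexCancellation_assoc (ϖ : R)
    (hR : ∀ e : R, e ≠ 0 → ∃ (v : ℕ) (u : Rˣ), e = ϖ ^ v * ↑u)
    (hϖ : Prime (PowerSeries.C (R := R) ϖ))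
    {L c : PowerSeries (PowerSeries R)} {h : PowerSeries R} {lam : R} {θ : PowerSeries R}
    (hh : h ≠ 0) (hdiv : L ∣ PowerSeries.map (PowerSeries.C (R := R)) h * c)
    (hL : Associated (PowerSeries.constantCoeff (R := PowerSeries R) L) (PowerSeries.C (R := R) lam * θ))
    (hlam : lam ≠ 0) (hμ : ¬ PowerSeries.C (R := R) ϖ ∣ θ) :
    θ ∣ PowerSeries.constantCoeff (R := PowerSeries R) c := by
  obtain ⟨u, hu⟩ := hL
  -- `L⁻ = C λ · (θ · u⁻¹)`
  have hL' : PowerSeries.constantCoeff (R := PowerSeries R) L =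
      PowerSeries.C (R := R) lam * (θ * ↑u⁻¹) := by
    rw [← mul_assoc, ← hu, mul_assoc, Units.mul_inv, mul_one]
  have hμ' : ¬ PowerSeries.C (R := R) ϖ ∣ θ * ↑u⁻¹ := fun hd =>
    hμ (by simpa using hd.mul_right (↑u : PowerSeries R))
  have key := definiteVertexCancellation ϖ hR hϖ hh hdiv hL' hlam hμ'
  exact (dvd_trans (Units.dvd_mul_right.mpr (dvd_refl θ)) key)

/-! ### The card's rank-2 crux, typed at CURVE level (critic V#27a price P2)

`CLW⁺`: the rational two-variable Greenberg inclusion of Castella–Liu–Wan 2022 Thm 8.2.1 / BSTW Thm 9.24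
(GMC_r(a)) with the square-free / "principal series at split primes" hypothesis DROPPED at the primes
that split in `K`, keeping a nonsplit prime of (exactly) multiplicative reduction — the shape of a
level-raised vertex `(E′, K)` of BLV's induction whose newform has RATIONAL coefficients (`E′` of
conductor `N·L`, `N = N_E` arbitrary and split in `K`, `L` square-free inert Steinberg).  It is the tree's
`BurungaleSkinnerTianWan2024.thm924_greenberg_dvd_charIdealXGr₂_awayFromCyc_OPEN` with `Squarefree N`
replaced by "every prime of bad reduction that does not split in `K` divides `N` exactly once", and
(irr_L) replaced by the crux's own `Rank1Residual.Surj` binder.  The general vertex (`ξ` with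
`𝒪_λ`-coefficients, `J_ξ` of GL₂-type) needs a λ-adic `XGr₂` the tree does not have yet (definition
request D1 of the card); this curve-level instance is the typable core and already lies OUTSIDE every
printed statement (CLW22 §5.2 (i); BSTW Thm 9.24 `N` square-free). -/

open Literature.NumberTheory.EllipticCurves in
/-- crux (rank 2) of idea `admdef`, curve level: **CLW⁺** — GMC_r(a) away from the cyclotomic variable
for `(E′, K)` with arbitrary powers of SPLIT primes in the conductor and a nonsplit exactly-multiplicative
prime.  Conclusion shape copied from `thm924_greenberg_dvd_charIdealXGr₂_awayFromCyc_OPEN`. -/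
def CLWPlusCurveLevel : Prop :=
  ∀ {p : ℕ} [Fact p.Prime] (ι : PadicAlgCl p ≃+* ℂ) (W : WeierstrassCurve ℚ) [W.IsElliptic]
    [W.IsGloballyMinimal] (K : Type) [Field K] [NumberField K]
    (v vbar : IsDedekindDomain.HeightOneSpectrum (NumberField.RingOfIntegers K))
    (κ₁ κ₂ : ZpExtension K p) (γ₁ γ₂ : Field.absoluteGaloisGroup K)
    [Fact (ZpExtension.IsTopGeneratorPair κ₁ κ₂ γ₁ γ₂)] {N : ℕ} [NeZero N]
    {f : CuspForm (CongruenceSubgroup.Gamma0 N) 2}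
    (_ : ModularForms.IsNewformOf W f) [NeZero (NumberField.discr K).natAbs],
    -- level `N = N_{E′}` ARBITRARY at split primes; `p ≥ 5` good; `ρ̄` surjective (⊇ (irr_L), CLW (iv))
    (N : ℤ) = W.conductorNorm ℤ → 5 ≤ p → ¬ p ∣ N → Rank1Residual.Surj W p →
    -- `K` imaginary quadratic, `p = v v̄` split, `v` induced by `ι`, `(N, D_K) = 1`
    IsImaginaryQuadratic K → ((Ideal.span {(p : ℤ)}).primesOver (NumberField.RingOfIntegers K)).ncard = 2 →
    ((p : ℕ) : NumberField.RingOfIntegers K) ∈ v.asIdeal →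
    ((p : ℕ) : NumberField.RingOfIntegers K) ∈ vbar.asIdeal → vbar ≠ v →
    (∀ (w : NumberField.InfinitePlace K) (k : NumberField.RingOfIntegers K),
      k ∈ v.asIdeal ↔ ‖ι.symm (w.embedding (k : K))‖ < 1) →
    IsCoprime (N : ℤ) (NumberField.discr K) →
    -- (spl)⁺: SOME bad prime does not split in `K`, and EVERY such prime divides `N` exactly once
    -- (multiplicative reduction — e.g. an admissible prime); split bad primes are unrestricted
    (∃ q : ℕ, q.Prime ∧ q ∣ N ∧ ((Ideal.span {(q : ℤ)}).primesOver (NumberField.RingOfIntegers K)).ncard ≠ 2) →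
    (∀ q : ℕ, q.Prime → q ∣ N →
      ((Ideal.span {(q : ℤ)}).primesOver (NumberField.RingOfIntegers K)).ncard ≠ 2 → ¬ q ^ 2 ∣ N) →
    -- CLW22 §5.2 (iii), 2-adic clause (transfer step T4 keeps it verbatim)
    (((Ideal.span {(2 : ℤ)}).primesOver (NumberField.RingOfIntegers K)).ncard = 2 ∨ 2 ∣ N) →
    κ₁.IsCyclotomic → κ₂.IsAnticyclotomic →
    ∀ (Ω δ : ℂ) (Ωp : (unrIntegers p)ˣ) (LK G : PowerSeries (PowerSeries (PadicComplexInt p))),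
      Ω ≠ 0 → (δ ^ 2 = (NumberField.discr K : ℂ) ∨ δ ^ 2 = -(NumberField.discr K : ℂ)) →
      IsKatzMeasure₂ ι v vbar ∅ κ₁ κ₂ γ₁⁻¹ γ₂⁻¹ 1 Ω δ ((Ωp : unrIntegers p) : PadicComplex p) LK →
      IsGreenbergLFunctionAnyRoot₂ ι v vbar κ₁ κ₂ γ₁⁻¹ γ₂⁻¹ f (NumberField.discr K).natAbs
        (NumberField.classNumber K) LK G →
    ∀ J : ℤ_[p] →+* PadicComplexInt p,
      (∀ x : ℤ_[p], ((J x : PadicComplexInt p) : PadicComplex p) = ((x : ℚ_[p]) : PadicComplex p)) →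
    ∃ s : PowerSeries (PadicComplexInt p), s ≠ 0 ∧
      Ideal.span {PowerSeries.map (PowerSeries.C (R := PadicComplexInt p)) s} *
          (WeierstrassCurve.XGr₂.charIdeal (W.baseChange K) p κ₁ κ₂ vbar γ₁ γ₂).map
            (IwasawaAlgebra₂.toUnr₂ p J) ≤
        Ideal.span {G}

open Literature.NumberTheory.EllipticCurves in
/-- Sanity: `CLW⁺` at curve level CONTAINS the printed square-free statement's content on its overlap —
recorded as the trivial observation that the square-free hypothesis implies (spl)⁺'s second clause. -/
theorem sqfree_imp_splPlus {N : ℕ} (hN : Squarefree N) (K : Type) [Field K] [NumberField K] :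
    ∀ q : ℕ, q.Prime → q ∣ N →
      ((Ideal.span {(q : ℤ)}).primesOver (NumberField.RingOfIntegers K)).ncard ≠ 2 → ¬ q ^ 2 ∣ N := by
  intro q hq _ _ hsq
  have := hN q (by simpa [sq] using hsq)
  exact hq.not_isUnit (by simpa using this)

end Summit.BirchSwinnertonDyer.BirchSwinnertonDyer.Cruxes.AnticyclotomicEisensteinDivisibility.Admdef

/-!
## Assembly B (g18): the second consumer — Castella–Hsu–Kundu–Lee–Liu 2025 §7 ported off square-free level

Transfer reading (card `Ideas/admdef.md` rev 1.3, §Assembly B): in CHKLL25 (arXiv:2308.10474v2, TAMS Ser. B 12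
(2025)) Thm. 7.1 / Cor. 7.2 the hypothesis (i) «N square-free» is consumed ONLY through Thm. 7.6 (ii) «M
square-free» (rank-0 p-part BSD over K for ONE level-raised definite vertex g, via CÇSS18 Thm. C / FW Cor. 1.10)
and the congruence-number identity [PW11 Thm. 6.8 / Zha14 Thm. 6.4] (p0031 L63, p0033 L12–L20), and §7.4 opens
with «By Theorem 7.5 and the construction of λ±_j of Theorem 7.4, it suffices to show that there exists
m ∈ N^def and an m-new eigenform g … f ≡ g (mod ℘), for which L±_p(g/K) is invertible» (p0033 L1–L4) —
exactly the conclusion of this card's `DefVertexUnit` at the vertex (g, K) supplied by Zhang's rank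
lowering.  `CHKLLPlusRat` below is the tree's named fact
`CastellaHsuKunduLeeLiu2025.thm71_cor72_exists_isCWBDPLFunction_charIdeal_map_le_rat` with the single binder
`Squarefree N →` DELETED and nothing else changed (so its consumer glue on route SignedBaseChange is unchanged);
it is a CONJECTURE-LEVEL transfer target C⁺⁺, not a fact, and nothing is registered (W-79).
`chkll_of_chkllPlusRat` records that C⁺⁺ is at least as strong as the printed theorem's typed form.

RELIABILITY FLAG carried by C⁺⁺ (v5, critic V#27e π1/π2): `CHKLL-inputs` — the name of the tree fact's own flag
(«square-free level for [PW11]/[DI08]; CR for the level raising»).  The port of Thm. 7.4's `±` bipartite system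
(DI08 §4 + PW11 §4.3) to arbitrary `N⁺` is a PORT-BY-ANALOGY: the refereed ports in print — C.-H. Kim, AJM 21 (2017)
Rem. 6.6 («[PW11] … naturally extends to our setting without changing any argument»), W. Zhang 2014 §§2–4,
Chida–Hsieh 2015 (CR⁺) — are written in the ORDINARY setting; the supersingular local conditions at `v ∣ p`
(CW24 Def. 4.6 / Kim07) are level-blind and the level enters only through the definite Shimura set / Jacobian at
`N⁺m`, but no supersingular print states it.  CW24 itself (§2 setting, MS p. 5, tree
`CastellaWan2024/GreenbergMainConjectureBDP.lean` docstring: «If `N⁻ ≠ 1`, assume that `N` is squarefree») imposes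
no square-free hypothesis at `N⁻ = 1`, which is the case of this crux (every `ℓ ∣ N` split); Thm. 6.8 / Lem. 6.5 are
applied to `f` of level `N` only.
-/

namespace Summit.BirchSwinnertonDyer.BirchSwinnertonDyer.Cruxes.AnticyclotomicEisensteinDivisibility.Admdef

open scoped NumberField
open NumberField IsDedekindDomain Field
open Literature.NumberTheory.EllipticCurves Literature.NumberTheory.EllipticCurves.ModularForms
  Literature.NumberTheory.EllipticCurves.Rank1Residual Literature.NumberTheory.EllipticCurves.Castella2018
  Literature.NumberTheory.EllipticCurves.CastellaWan2024 Literature.NumberTheory.GaloisRepresentations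

/-- **C⁺⁺ (Assembly B): CHKLL25 Thm. 7.1 / Cor. 7.2 (`N⁻ = 1`, rational Eisenstein half, the tree's
currency) WITHOUT hypothesis (i) `Squarefree N`.**  Binder-for-binder the tree's fact
`thm71_cor72_exists_isCWBDPLFunction_charIdeal_map_le_rat` with the line `Squarefree N →` removed:
`p ≥ 5` good, `a_p = 0`, `ρ̄_{E,p}` surjective, `K` imaginary quadratic with `p = 𝔭𝔭̄` split, every
`ℓ ∣ N` split in `K`, `(N, D_K) = 1`, `p ∤ h_K`, (ii) `E[p]` ramified at every prime `q ∣ N` (for `p ≥ 5`: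
automatic at additive `q`, and `p ∤ ord_q(Δ_E)` at multiplicative `q` — cells α ∪ β of
`PrimkolyCells.lean`), anticyclotomic `κ`.  OPEN; the transfer target of Assembly B; no `_holds`; reliability
flag `CHKLL-inputs` (PORT-BY-ANALOGY of the `±` bipartite system to arbitrary `N⁺`, see the section docstring). -/
def CHKLLPlusRat : Prop :=
  ∀ {p : ℕ} [Fact p.Prime] (ι : PadicAlgCl p ≃+* ℂ) (W : WeierstrassCurve ℚ) [W.IsElliptic]
    [W.IsGloballyMinimal] (K : Type) [Field K] [NumberField K]
    (𝔭 𝔭bar : HeightOneSpectrum (𝓞 K)) (κ : ZpExtension K p) (γ : absoluteGaloisGroup K)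
    [Fact (κ.IsTopGenerator γ)] {N : ℕ} [NeZero N] {f : CuspForm (CongruenceSubgroup.Gamma0 N) 2}
    (_ : IsNewformOf W f),
    (N : ℤ) = W.conductorNorm ℤ → 5 ≤ p → W.HasGoodReductionAtPrime p → W.frobeniusTrace p = 0 →
    Surj W p →
    IsImaginaryQuadratic K → ((Ideal.span {(p : ℤ)}).primesOver (𝓞 K)).ncard = 2 →
      ((p : ℕ) : 𝓞 K) ∈ 𝔭.asIdeal →
      (∀ (w : InfinitePlace K) (k : 𝓞 K), k ∈ 𝔭.asIdeal ↔ ‖ι.symm (w.embedding (k : K))‖ < 1) →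
      ((p : ℕ) : 𝓞 K) ∈ 𝔭bar.asIdeal → 𝔭bar ≠ 𝔭 →
    (∀ ℓ : ℕ, ℓ.Prime → ℓ ∣ N → ((Ideal.span {(ℓ : ℤ)}).primesOver (𝓞 K)).ncard = 2) →
    IsCoprime (N : ℤ) (NumberField.discr K) → ¬ p ∣ NumberField.classNumber K →
    -- (ii) ONLY: `E[p]` ramified at every prime `q ∣ N` (hypothesis (i) `Squarefree N` deleted)
    (∀ q : ℕ, q.Prime → q ∣ N →
      ∃ v : HeightOneSpectrum (𝓞 ℚ), ((q : ℕ) : 𝓞 ℚ) ∈ v.asIdeal ∧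
        ∃ 𝔓 ∈ v.primesAbove, ∃ σ ∈ 𝔓.inertia (absoluteGaloisGroup ℚ),
          ∃ P : W.geomTorsion (p : ℤ), σ • P ≠ P) →
    κ.IsAnticyclotomic →
    ∃ (ΩK : ℂ) (Ωp : (unrIntegers p)ˣ) (L : UnrSeries p),
      ΩK ≠ 0 ∧
      IsCWBDPLFunction ι 𝔭 κ γ f (NumberField.discr K) ΩK ((Ωp : unrIntegers p) : ℂ_[p]) L ∧
      ∀ (j : ℤ_[p] →+* unrIntegers p),
        (∀ x : ℤ_[p], ((j x : unrIntegers p) : ℂ_[p]) = algebraMap ℚ_[p] ℂ_[p] (x : ℚ_[p])) →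
        ∃ k : ℕ,
          Ideal.span {PowerSeries.C ((p : unrIntegers p) ^ k)} *
              (AcSelmer.XAc.charIdeal (W.baseChange K) p κ 𝔭bar ∅ γ).map (PowerSeries.map j) ≤
            Ideal.span {L}

/-- Sanity (PROVED): C⁺⁺ implies the typed printed theorem — the square-free binder is simply not used. -/
theorem chkll_of_chkllPlusRat (h : CHKLLPlusRat) :
    CastellaHsuKunduLeeLiu2025.thm71_cor72_exists_isCWBDPLFunction_charIdeal_map_le_rat := by
  intro p _ ι W _ _ K _ _ 𝔭 𝔭bar κ γ _ N _ f hf hN hp hgood hap hsurj hK hsplit h𝔭 hι h𝔭bar hne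
    hHeeg hcop hh _hsq hram hac
  exact h ι W K 𝔭 𝔭bar κ γ hf hN hp hgood hap hsurj hK hsplit h𝔭 hι h𝔭bar hne hHeeg hcop hh hram hac

end Summit.BirchSwinnertonDyer.BirchSwinnertonDyer.Cruxes.AnticyclotomicEisensteinDivisibility.Admdef

/-!
## K1 anatomy (g19): where CLW22 uses hypothesis §5.2 (i) at SPLIT places, and the abstract lemma behind the soft case

Located use-ledger of CLW22 (arXiv:2109.08375v2) hypothesis §5.2 (i) «π_v unramified, Steinberg, or Steinberg
twisted by an unramified quadratic character at every finite v» restricted to the places that SPLIT in `K` — the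
only residual of `CLWPlusCurveLevel` above, since in the admdef setting every bad prime of `E` splits in `K`
((Heeg)) and the one nonsplit bad prime of the level-raised vertex is the admissible prime (Steinberg):
U1 §5.6 conductor bookkeeping `c_v = ord_v cond(π_v)` (p. 25 L35–40, p. 26 L48–60) — type-blind;
U2 §5.7.3 big-cell Siegel section at `v ∈ Σ` (p. 27 L14–24) — type-blind;
U3 §6.1 local doubling zeta integral `Z_v` «[WanU31] or an easy direct computation» (p. 34 L50–60) — type-blind
    (depends on `c_v` and `⟨φ_v, φ'_v⟩` only);
U4 §7.11 eq. (tri): the SPLIT-place local triple-product integral is «a nonzero constant independent of τ — this is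
    [WanU31]; the twist (eq:f-twist) guarantees it is nonzero» (p. 50 L38–45) — THE ONLY TYPE-DEPENDENT USE at split v;
U5 the twisted test-vector recipe (eq:f-twist) / Remark 5.6.2 (p. 26 L77–95), flexibility `L[GU(2)(ℚ_v)]·f` granted
    only at `Σ_ns ∪ {ℓ′}` (eq:M-varphi);
U6 §8 lattice construction and Thm. 8.2.1(1) (p. 55 L15–48, p. 56) — no use of (i) (Prop. 7.12.1 Case 1 uses (i) only
    at NONSPLIT `v ≠ q`, p. 52);
U7 the p-adic L-function is the Σ-imprimitive doubling one of [EisWan] (p. 3 L45–60), made primitive by [JSW]/[GrVa]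
    (p. 55 L60–66): at a split supercuspidal place `L_v(BC(π) × ξ) = 1`, so the Σ → primitive step is vacuous there;
U8 Selmer local conditions at an additive split place are trivial for `p ≥ 5` (`E[p]^{I_v} = 0`).
Print coverage of U4 at split places: X. Wan, ANT 9 (2015) = arXiv:1408.4044 Lemma 7.7 (principal series, ramified
allowed: `cond(χ_{f,1}χ_{f,2}^{-1}) = ϖ^{t₁}`, `I_v = q/(q−1)·Vol(K_{t₂})`, p. 37 L26 – p. 39 L10), Lemma 7.8 (special),
Remark 7.11 (τ-variation = unramified twists, p. 40 L4–8); X. Wan, arXiv:1607.07729 Prop. 3.7 / Cor. 3.8 (supercuspidal,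
trivial central character, conductor `ℓ^t`, `t ≥ 2`, new vector, auxiliary characters of conductor `ℓ^{t₁}`, `t₁ > t`:
`I_ℓ = Vol(K_{t₁})`, «an easy consequence of [Hu]», p. 17 L28–36; preprint).

S1 (soft lemma, the «why easier» of the transfer at split supercuspidal places, `ℓ ≥ 5`).  For `ℓ ≥ 5` of additive
reduction the conductor exponent of `E` at `ℓ` is exactly 2, so a supercuspidal `π_ℓ` is of DEPTH ZERO
(induced from the inflation to `ℤ_ℓ^× GL₂(ℤ_ℓ)` of a cuspidal representation of `GL₂(𝔽_ℓ)`); with a type vector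
`φ_ℓ ∈ π_ℓ^{K(ℓ)}`-isotypic part the matrix coefficient `c_φ` is supported on `Z·GL₂(ℤ_ℓ)`, hence Ichino's local integral
`I_ℓ = ∫_{K/(Z∩K)} c_φ(k) ⟨π_θ(k)a, a'⟩ ⟨π_h(k)b, b'⟩ dk` only sees the restrictions to `GL₂(ℤ_ℓ)` of the two CM
principal series, which depend on `χ_θ|_{𝒪^×}`, `χ_h|_{𝒪^×}` alone — and these are τ-INDEPENDENT at split `v` by CLW22
Prop. 7.7.1 / 7.7.3 (`χ_hτ|_{𝒪^×_{K,v}} = χ_h|`, `χ_θ τ^{-c}| = χ_θ|`, p. 45 L5, L62).  NONVANISHING for suitable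
`K`-finite vectors `(a, b)` then follows from Prasad's `dim Hom_{GL₂}(π_ℓ ⊗ π_θ ⊗ π_h, ℂ) = 1` (a principal-series
factor is present), Ichino's `I = |ℓ|-normalised L ⊗ L̄ ≠ 0` on the product, and the abstract `G`-span transport
PROVED below (`trilinear_eq_zero_of_generator_vanishing`, `exists_ne_zero_of_generator`, `span_orbit_eq_top`):
an invariant trilinear form that is not identically zero cannot vanish on `{u} × V₂ × V₃` when `u` generates `V₁`
— so the test vector in the supercuspidal slot may be FIXED (the type vector) and only the CM slots need CLW's own
flexibility device of Prop. 7.12.1 (`T_v ∈ 𝒪_L[GL₂(ℚ_v)]` acting on `h̆`, i.e. extend (eq:M-varphi)'s flexibility set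
from `Σ_ns ∪ {ℓ′}` to the split supercuspidal places).  Residual R1 (not soft): wild supercuspidal `π_ℓ`, `ℓ ∈ {2, 3}`
split in `K` — covered in print only by Wan16 Cor. 3.8 ⟸ Y. Hu, IMRN 2018 rnw322 = arXiv:1409.8173 (2-adic caveat = card F1/Q1).
Falsifier F5 of S1: any use of the explicit shape of `f^{GU(2)}_{χ_h}` at a split place outside §7.11 (none found in
§6.1 / Prop. 7.11.1 / §8).  Nothing here is registered; BSD is not proved by any of this.
-/

namespace Summit.BirchSwinnertonDyer.BirchSwinnertonDyer.Cruxes.AnticyclotomicEisensteinDivisibility.Admdef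

section GSpan

variable {k G V₁ V₂ V₃ : Type*} [Field k] [Group G]
  [AddCommGroup V₁] [Module k V₁] [AddCommGroup V₂] [Module k V₂] [AddCommGroup V₃] [Module k V₃]

/-- `ρ g (ρ g⁻¹ y) = y` for a group representation. -/
theorem rep_apply_inv_apply {V : Type*} [AddCommGroup V] [Module k V] (ρ : Representation k G V)
    (g : G) (y : V) : ρ g (ρ g⁻¹ y) = y := by
  rw [← Module.End.mul_apply, ← map_mul, mul_inv_cancel, map_one, Module.End.one_apply]

/-- **G-span transport (PROVED).**  A `G`-invariant trilinear form that vanishes on `{u} × V₂ × V₃` for a vector `u`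
whose `G`-orbit spans `V₁` vanishes identically.  (Model: `V₁ = π_ℓ` supercuspidal with its type / new vector `u`,
`V₂, V₃` the CM principal series, `L` = Ichino's local trilinear form at a split place.) -/
theorem trilinear_eq_zero_of_generator_vanishing
    (ρ₁ : Representation k G V₁) (ρ₂ : Representation k G V₂) (ρ₃ : Representation k G V₃)
    (L : V₁ →ₗ[k] V₂ →ₗ[k] V₃ →ₗ[k] k)
    (hinv : ∀ g x y z, L (ρ₁ g x) (ρ₂ g y) (ρ₃ g z) = L x y z)
    (u : V₁) (hu : Submodule.span k (Set.range fun g => ρ₁ g u) = ⊤)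
    (h0 : ∀ y z, L u y z = 0) : L = 0 := by
  have hker : Submodule.span k (Set.range fun g => ρ₁ g u) ≤ LinearMap.ker L := by
    refine Submodule.span_le.mpr ?_
    rintro _ ⟨g, rfl⟩
    simp only [SetLike.mem_coe, LinearMap.mem_ker]
    ext y z
    have h := hinv g u (ρ₂ g⁻¹ y) (ρ₃ g⁻¹ z)
    rw [rep_apply_inv_apply, rep_apply_inv_apply] at h
    rw [LinearMap.zero_apply, LinearMap.zero_apply, h, h0]
  rw [hu, top_le_iff] at hker
  exact LinearMap.ker_eq_top.mp hker

/-- Contrapositive, the form used: a NONZERO invariant trilinear form takes a nonzero value with the generating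
vector `u` FIXED in the first slot (only the other two test vectors move). -/
theorem exists_ne_zero_of_generator
    (ρ₁ : Representation k G V₁) (ρ₂ : Representation k G V₂) (ρ₃ : Representation k G V₃)
    (L : V₁ →ₗ[k] V₂ →ₗ[k] V₃ →ₗ[k] k)
    (hinv : ∀ g x y z, L (ρ₁ g x) (ρ₂ g y) (ρ₃ g z) = L x y z)
    (u : V₁) (hu : Submodule.span k (Set.range fun g => ρ₁ g u) = ⊤) (hL : L ≠ 0) :
    ∃ y z, L u y z ≠ 0 := by
  by_contra h
  push Not at h
  exact hL (trilinear_eq_zero_of_generator_vanishing ρ₁ ρ₂ ρ₃ L hinv u hu h)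

/-- In an irreducible representation (no invariant `k`-submodule other than `⊥`, `⊤`) every nonzero vector
generates: the `k`-span of its orbit is everything.  Supplies `hu` above for the supercuspidal slot. -/
theorem span_orbit_eq_top {V : Type*} [AddCommGroup V] [Module k V] (ρ : Representation k G V)
    (hirr : ∀ W : Submodule k V, (∀ g, W.map (ρ g) ≤ W) → W = ⊥ ∨ W = ⊤)
    {u : V} (hu : u ≠ 0) : Submodule.span k (Set.range fun g => ρ g u) = ⊤ := by
  have hstab : ∀ g, (Submodule.span k (Set.range fun g => ρ g u)).map (ρ g) ≤
      Submodule.span k (Set.range fun g => ρ g u) := by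
    intro g
    rw [Submodule.map_span_le]
    rintro _ ⟨h, rfl⟩
    refine Submodule.subset_span ⟨g * h, ?_⟩
    simp only [map_mul, Module.End.mul_apply]
  rcases hirr _ hstab with hbot | htop
  · exfalso
    apply hu
    have hmem : u ∈ Submodule.span k (Set.range fun g => ρ g u) := Submodule.subset_span ⟨1, by simp⟩
    rw [hbot] at hmem
    exact (Submodule.mem_bot k).mp hmem
  · exact htop

/-- The three lemmas assembled in the shape S1 consumes: irreducible first factor, nonzero invariant trilinear
form, any fixed nonzero first test vector ⇒ a nonvanishing value exists. -/
theorem exists_ne_zero_of_irreducible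
    (ρ₁ : Representation k G V₁) (ρ₂ : Representation k G V₂) (ρ₃ : Representation k G V₃)
    (hirr : ∀ W : Submodule k V₁, (∀ g, W.map (ρ₁ g) ≤ W) → W = ⊥ ∨ W = ⊤)
    (L : V₁ →ₗ[k] V₂ →ₗ[k] V₃ →ₗ[k] k)
    (hinv : ∀ g x y z, L (ρ₁ g x) (ρ₂ g y) (ρ₃ g z) = L x y z) (hL : L ≠ 0)
    {u : V₁} (hu : u ≠ 0) : ∃ y z, L u y z ≠ 0 :=
  exists_ne_zero_of_generator ρ₁ ρ₂ ρ₃ L hinv u (span_orbit_eq_top ρ₁ hirr hu) hL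

end GSpan

end Summit.BirchSwinnertonDyer.BirchSwinnertonDyer.Cruxes.AnticyclotomicEisensteinDivisibility.Admdef
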